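import Mathlib
import HarnessLib
import Summits.HubbardSuperconductivity.HubbardSuperconductivity.Theorems.KLProgrammeKLRegimeEngineScaleZeroE4Defs
import Literature.Probability.LatticeModels.TorusCentredLift
import Literature.MathematicalPhysics.QuantumLattice.LatticeTori
import Literature.MathematicalPhysics.QuantumLattice.GrassmannKernels

/-!
# Bridge between the two-volume chain's torus distance `Torus.tnorm` and the scale-`0` engine's label distance `gridLabelDist`

The two-volume block step (`hubbardGrid_sum_norm_kernel_sub_le`, its profile `Nw`) and the read-out door
(`abs_klLocalPart_flowFrame_zero_sub_le`, its fine profile `Nw₁`) weigh pinned kernel families by `1 + diam` for the pseudo-distance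
`(Y₁, Y₂) ↦ Torus.tnorm (Y₁.site − Y₂.site)` on grid legs.  The scale-`0` engine's weighted single-scale step exports its profiles in the
weight `gridLabelWt L Ng β = 1 + diam_{gridLabelDist}` of the leg POSITIONS `gridLegPos` (`gridLabelDist = (β/Ng)·cyclicDist + torusSiteDist`).
Here: `Torus.tnorm = torusNorm` (both are the periodic `ℓ^∞` norm), hence `Torus.tnorm (x − y) = torusSiteDist x y ≤ gridLabelDist` at the
positions (`0 ≤ β`), the `1 + diam` weights compare, and a profile bound in the engine's weight IS a profile bound in the two-volume weight.
-/

namespace Summit.HubbardSuperconductivity.HubbardSuperconductivity.Theorems.TwoVolumeDefect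

open Finset Literature.MathematicalPhysics.QuantumLattice GrassmannAlgebra Literature.Probability.LatticeModels BattleFederbush
open Summit.HubbardSuperconductivity.HubbardSuperconductivity.Theorems.EngineV8

section Torus

variable {d L : ℕ} [NeZero L]

/-- `Torus.tnorm u = torusNorm u`: the sup over the coordinates of `|valMinAbs|` is the sup of `min (val, L − val)`. -/
theorem tnorm_eq_torusNorm (u : TorusSite d L) : Torus.tnorm u = torusNorm (Ls := fun _ : Fin d => L) u := by
  unfold Torus.tnorm Site.supNorm torusNorm
  refine Finset.sup_congr rfl fun i _ => ?_
  have h : Torus.cRep u i = (u i).valMinAbs := by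
    rw [Torus.cRep]
    unfold Torus.cRepZ ZMod.valMinAbs
    cases L with
    | zero => exact absurd rfl (NeZero.ne 0)
    | succ n => simp only [ZMod.val]; split_ifs <;> first | rfl | omega
  rw [h, ZMod.valMinAbs_natAbs_eq_min]

/-- `Torus.tnorm (x − y) = torusSiteDist x y` (as reals). -/
theorem tnorm_sub_eq_torusSiteDist (x y : TorusSite d L) : (Torus.tnorm (x - y) : ℝ) = torusSiteDist x y := by
  rw [torusSiteDist, torusDist, tnorm_eq_torusNorm]

end Torus

section Grid

variable {L Ng : ℕ} [NeZero L]

/-- At the leg positions the torus distance of the sites is dominated by the engine's label distance (`0 ≤ β`). -/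
theorem tnorm_sub_le_gridLabelDist {β : ℝ} (hβ : 0 ≤ β) (X Y : GridLeg (GridPoint L Ng)) :
    (Torus.tnorm (X.1.1.2 - Y.1.1.2) : ℝ) ≤ gridLabelDist L Ng β (gridLegPos X) (gridLegPos Y) := by
  rw [gridLabelDist_apply, gridLegPos_apply, gridLegPos_apply, tnorm_sub_eq_torusSiteDist]
  dsimp only
  have hc : 0 ≤ cyclicDist Ng (((X.1.1.1 : ℕ) : ZMod Ng)) (((Y.1.1.1 : ℕ) : ZMod Ng)) := by unfold cyclicDist; positivity
  have hb : 0 ≤ β / Ng * cyclicDist Ng (((X.1.1.1 : ℕ) : ZMod Ng)) (((Y.1.1.1 : ℕ) : ZMod Ng)) := mul_nonneg (by positivity) hc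
  linarith

/-- **The `1 + diam` weights compare**: `1 + diam_{tnorm}(S) ≤ gridLabelWt L Ng β (S.image gridLegPos)` (`0 ≤ β`). -/
theorem one_add_labelDiam_tnorm_le_gridLabelWt {β : ℝ} (hβ : 0 ≤ β) (S : Finset (GridLeg (GridPoint L Ng))) :
    1 + labelDiam (fun Y₁ Y₂ : GridLeg (GridPoint L Ng) => (Torus.tnorm (Y₁.1.1.2 - Y₂.1.1.2) : ℝ)) S ≤
      gridLabelWt L Ng β (S.image gridLegPos) := by
  classical
  rw [gridLabelWt_apply]
  refine add_le_add_right (labelDiam_le _ (labelDiam_nonneg _ _) fun a ha b hb => ?_) 1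
  exact (tnorm_sub_le_gridLabelDist hβ a b).trans (le_labelDiam _ (mem_image_of_mem _ ha) (mem_image_of_mem _ hb))

/-- **A pinned profile in the engine's weight is a pinned profile in the two-volume weight** (any degree `m`, any pinned leg, any element
`W` of the grid Grassmann algebra; `0 ≤ β`): the `hNw`-shaped hypothesis of `hubbardGrid_sum_norm_kernel_sub_le` /
`abs_klLocalPart_flowFrame_zero_sub_le` from the weighted single-scale step's output shape `Σ wt(image Y)·‖W_m(Y)‖ ≤ Nw`. -/
theorem sum_norm_kernel_mul_one_add_labelDiam_le_of_gridLabelWt {β : ℝ} (hβ : 0 ≤ β) (W : GrassmannAlgebra ℂ (GridLeg (GridPoint L Ng)))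
    {m : ℕ} (j : Fin m) (x : GridLeg (GridPoint L Ng)) {Nw : ℝ}
    (h : ∑ Y ∈ univ.filter (fun Y : Fin m → GridLeg (GridPoint L Ng) => Y j = x),
      gridLabelWt L Ng β ((univ.image Y).image gridLegPos) * ‖kernel ℂ W m Y‖ ≤ Nw) :
    ∑ Y ∈ univ.filter (fun Y : Fin m → GridLeg (GridPoint L Ng) => Y j = x),
      ‖kernel ℂ W m Y‖ * (1 + labelDiam (fun Y₁ Y₂ : GridLeg (GridPoint L Ng) => (Torus.tnorm (Y₁.1.1.2 - Y₂.1.1.2) : ℝ)) (univ.image Y)) ≤ Nw := by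
  classical
  refine le_trans (sum_le_sum fun Y _ => ?_) h
  rw [mul_comm]
  exact mul_le_mul_of_nonneg_right (one_add_labelDiam_tnorm_le_gridLabelWt hβ _) (norm_nonneg _)

/-- The same with the position image written `univ.image (gridLegPos ∘ Y)`. -/
theorem sum_norm_kernel_mul_one_add_labelDiam_le_of_gridLabelWt' {β : ℝ} (hβ : 0 ≤ β) (W : GrassmannAlgebra ℂ (GridLeg (GridPoint L Ng)))
    {m : ℕ} (j : Fin m) (x : GridLeg (GridPoint L Ng)) {Nw : ℝ}
    (h : ∑ Y ∈ univ.filter (fun Y : Fin m → GridLeg (GridPoint L Ng) => Y j = x),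
      gridLabelWt L Ng β (univ.image (gridLegPos ∘ Y)) * ‖kernel ℂ W m Y‖ ≤ Nw) :
    ∑ Y ∈ univ.filter (fun Y : Fin m → GridLeg (GridPoint L Ng) => Y j = x),
      ‖kernel ℂ W m Y‖ * (1 + labelDiam (fun Y₁ Y₂ : GridLeg (GridPoint L Ng) => (Torus.tnorm (Y₁.1.1.2 - Y₂.1.1.2) : ℝ)) (univ.image Y)) ≤ Nw := by
  classical
  refine sum_norm_kernel_mul_one_add_labelDiam_le_of_gridLabelWt hβ W j x (le_of_eq_of_le (sum_congr rfl fun Y _ => ?_) h)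
  rw [← Finset.image_image]

end Grid

end Summit.HubbardSuperconductivity.HubbardSuperconductivity.Theorems.TwoVolumeDefect
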